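import Summits.ABC.IUTFork.Joshi.ATS4TateDivisors
import Summits.ABC.IUTFork.Joshi.ArithmeticoidPeriods
import Summits.ABC.IUTFork.Joshi.ArithmeticoidsNumberFieldModel
import Mathlib.Analysis.SpecialFunctions.Pow.Real
import Mathlib.Analysis.SpecialFunctions.Log.Basic
import HarnessLib

/-!
# Joshi, *Arithmetic Teichmüller Spaces IV* (arXiv:2403.10430v2) §4.5: the Tate idele `TI_{C/arith(L)_z}` and its
# «normalized arithmetic degree» READ OVER Joshi's own [J-2½] deformation datum — a kernel test of Prop. 4.5.12

Companion file of `Joshi/ATS4TateDivisors.lean` (abc-iut cell, branch E «type Joshi's construction, test vs S», rung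
LADDER-ABC:A2.E; seat abc-iut-E-t27, slot T-27). **No side is taken** on [IUTchIII] Cor. 3.12, on Joshi's claims, or on
Mochizuki's reports on them; the sources are unrefereed arXiv preprints; TYPED ≠ PROVED ≠ ENDORSED; a model exhibits
satisfiability, nothing more. Locators «p.N l.M» = line M of page file `pNNNN.txt` of the renders
`HOME/lit/renders/Joshi-arxiv-2403.10430/` ([J-IV], v2) and `HOME/plan/repair/lit/renders/Joshi-arxiv-2305.10398-ATS2half/`
([J-2½]). Inputs BY NAME (nothing restated): seat E-t37's `ATS2h.DeformationDatum` (the 28-field signature of [J-2½] §4–§5: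
an arithmeticoid `arith(L)_z` IS a point `z ∈ 𝒴_L`; residue fields `K_{z_v}` with `|−|_{K_{z_v}}`, the untilt maps
`ι_{z_v} : L_v ↪ K_{z_v}`, the normalization coordinate `α_v(z_v)` of (5.3.3) `|x|_v = |ι_{z_v}(x)|^{α_v(z_v)}_{K_{z_v}}`) and
its [J-2½] Def. 5.4.3 NORMALISED DEGREE `DeformationDatum.deg z (x_v)_v = Σ_v α_v(z_v)·log|x_v|_{K_{z_v}}`
(`Joshi/ArithmeticoidPeriods.lean`); seat E-t27's interim carrier `ATS4.TateIdeleDatum` with `tateDegree` and the claim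
`TateDegreeNonConstant` = [J-IV] Prop. 4.5.12; seat E-t48's arithmetic model `ATS2h.NumberFieldModel.model L` of the
signature (every number field, all places, `α_v(y_n) = p_v^{−n}` along the Frobenius orbit). This pays the merge-debt
«`𝒴_L` = slot T-37» recorded in `ATS4TateDivisors.lean` for [J-IV] (4.5.1).

WHAT IS TYPED / PROVED. `TateParams D` = the input of [J-IV] (4.5.1)–(4.5.2) over `D`: the semistable support `V` (finite)
and «a choice of the Tate parameter `q_v` at `v ∈ V`», `q_v ∈ L_v^*` (p.42 l.75–88 «`TI_{C/arith(L)} = (q_v)_v ∈ ∏_v L_v^*`»);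
`TateParams.ideleK T z` = that idele pushed along `ι_{z_v}` into `∏_v K_{z_v}^*`, the units of the arithmetic ring of `arith(L)_z`
([J-2½] Def. 5.1.1) — the Tate idele OF THE HOLOMORPHOID `C/arith(L)_z`; it lies in the ideloid (`ideleK_mem_ideloid`).
(N) **normalised degree is `z`-free:** `deg_ideleK : deg_z(TI_z) = Σ_{v ∈ V} log|q_v|_v` for EVERY `z` — one line from (5.3.3)
(`alpha_mul_log_absK_emb`) — and `deg_ideleK_eq`. (R) **raw degree moves exactly with `α`:** `rawDeg T z = Σ_{v ∈ V}
log|ι_{z_v}(q_v)|_{K_{z_v}} = Σ_v α_v(z_v)⁻¹·log|q_v|_v` (`rawDeg_eq`), `rawDeg_eq_of_alpha_eq`, `exists_alpha_ne_of_rawDeg_ne`,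
and with one bad place and `|q_v|_v ≠ 1`: `rawDeg z ≠ rawDeg z' ↔ α_v(z_v) ≠ α_v(z'_v)` (`rawDeg_ne_iff_of_bad_eq_singleton`) —
Joshi's own explanation of Thm. 3.3.1, «`y ↦ |p|_{K_y}` is a highly non-trivial function» (p.37 l.1–3), in kernel currency.
BRIDGE to the typed Prop. 4.5.12: `TateParamsZ` adds the integer data of [J-IV] §4.2/§4.4 (`[L:ℚ]`, `ord_v`, uniformisers
`π_v`, «log v», and the normalisation `log|x|_v = −ord_v(x)·log v` on `V`); `datumNor` / `datumRaw` instantiate E-t27's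
`TateIdeleDatum` over `Y := 𝒴_L`, `K z v := L_v^*`, `y⁰ := D.pt0`, reading «log v» in the NORMALISED arithmeticoid
`arith(L)^nor_z` as Prop. 4.5.12 prescribes (p.44 l.24–26) — `−α_v(z_v)·log|ι_{z_v}(π_v)|_{K_{z_v}}` — resp. RAW,
`−log|ι_{z_v}(π_v)|_{K_{z_v}}`. PROVED: `datumNor_logN_eq` (`= log v`), `datumNor_tateDegree_eq` (`= [L:ℚ]⁻¹·Σ_v ord_v(q_v)·log v`,
the (4.2.2)-degree of the Tate divisor `q_{C/L}` of (4.5.5), `z`-free), `datumNor_tateDegree_eq_neg_deg` (`= −[L:ℚ]⁻¹·deg_z(TI_z)`),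
hence **`not_tateDegreeNonConstant_datumNor : ¬ TateDegreeNonConstant`** (by E-t27's `not_tateDegreeNonConstant_of_indep`);
raw side `datumRaw_tateDegree_eq`, `datumRaw_tateDegree_eq_of_alpha_eq`, `exists_alpha_ne_of_tateDegreeNonConstant_datumRaw`
(raw non-constancy ⇒ `α` varies on `V`), `tateDegreeNonConstant_datumRaw_of` (one bad place, `ord_v(q_v) ≠ 0`, `log v ≠ 0`,
`α_v(z_v) ≠ α_v(z'_v)` ⇒ raw `TateDegreeNonConstant`). NON-VACUITY at the arithmetic model (`NumberFieldModel.model L`, any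
number field, any finite place `w`): the raw degree IS non-constant (`model_rawDeg_nonconstant`: `α_w(y_0) = 1 ≠ p_w⁻¹ =
α_w(y_1)`), the normalised one constant (`model_deg_ideleK_eq`) — both horns inhabited on one datum of record.

LOCATED SENTENCE (no side; cf. seat E-t32's [J-III] analogue `Joshi/HodgeTheatersJoshiNormalisedDegree.lean` for Thm. 10.11.5.1
vs Prop. 10.3.3 (2)): for Tate parameters `q_v ∈ L_v^*` transported into the arithmeticoids by the untilt maps `ι_{z_v}`,
every `z`-dependence of `log(TI_{C/arith(L)_z})` lives in the un-normalised coordinate `α_v(z_v)` of (5.3.3) and VANISHES under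
the normalisation `arith(L)^nor_z` that Prop. 4.5.12 itself prescribes; on these carriers Prop. 4.5.12 as printed is constant in
kernel. What would make it non-constant is a `z`-dependent Tate-parameter CLASS not of the form `ι_z(q_v)` — Joshi's Thm. 3.3.1
(2)–(4) (p.36 l.5–33: values in distinct arithmeticoids «may not be directly compared»; comparison only «using [a chosen
anabelomorphism] `L*_{v,1} ≃ L*_{v,2}`») and Prop. 4.5.11's collation «under all the isomorphisms (of topological groups) of each
factor» (p.44 l.10–12; seat E-t38's N/W valuation dichotomy `Joshi/ArithmeticoidCollationOrd.lean`: Galois-provided collation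
preserves `ord`, all-isomorphism collation rescales Kummer classes by prime-to-`p` unit powers) — the attach point, recorded
not adjudicated. NOT here: any `Cor312*`/`Thm311*` binding (E-PLAN R14), the arithmeticoids themselves (T-37), Kummer theory
(4.5.7)–(4.5.10) beyond the abstract `kum`. No `sorry`, axiom, instance, notation, or new `Prop` fact; the claim tags record
provenance only; the model is [folklore].
-/

noncomputable section
namespace Summit.ABC.IUTFork.Joshi.ATS4
open ATS2h
variable {L : Type} [Field L] {V : Type} {Lv : V → Type} [∀ v, Field (Lv v)] {Y : V → Type}
  [∀ v, TopologicalSpace (Y v)] {K : (v : V) → Y v → Type} [∀ v y, Field (K v y)] [∀ v y, TopologicalSpace (K v y)]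
  {G : V → Type} [∀ v, Group (G v)] {A : V → Type} [∀ v, Group (A v)]

/-! ## (5.3.3) on local units: the one line everything rests on -/

/-- `|ι_{y}(x)|_{K_y} > 0` for `x ∈ L_v^*` (field homomorphisms are injective). [folklore] -/
theorem absK_emb_pos (D : ATS2h.DeformationDatum L V Lv Y K G A) (v : V) (y : Y v) (x : (Lv v)ˣ) :
    0 < D.absK v y (D.emb v y x) :=
  (D.absK_isValuedField v y).pos_of_ne_zero ((map_ne_zero_iff _ (D.emb v y).injective).2 x.ne_zero)

/-- **[J-2½] (5.3.3) in logarithms, on `L_v^*`** (p.32 l.22–44): `α_v(y)·log|ι_y(x)|_{K_y} = log|x|_v` for every point `y` of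
`|Y_{F_v,L_v}|` and every `x ∈ L_v^*` — the NORMALISED local degree of an `L_v`-rational element does not see the arithmeticoid.
DERIVED from the signature field `absLv_eq_rpow`. [claim: Joshi2023ATS2half, status: disputed] -/
theorem alpha_mul_log_absK_emb (D : ATS2h.DeformationDatum L V Lv Y K G A) (v : V) (y : Y v) (x : (Lv v)ˣ) :
    D.α v y * Real.log (D.absK v y (D.emb v y x)) = Real.log (D.absLv v x) := by
  rw [D.absLv_eq_rpow v y, Real.log_rpow (absK_emb_pos D v y x)]

/-- The RAW local degree of an `L_v`-rational element in the arithmeticoid through `y`: `log|ι_y(x)|_{K_y} = α_v(y)⁻¹·log|x|_v`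
— it rescales by exactly `α_v(y)⁻¹` ([J-2½] (5.3.3); [J-IV] p.37 l.1–3 «`y ↦ |p|_{K_y}` is a highly non-trivial function»).
[claim: Joshi2023ATS2half, status: disputed] -/
theorem log_absK_emb_eq (D : ATS2h.DeformationDatum L V Lv Y K G A) (v : V) (y : Y v) (x : (Lv v)ˣ) :
    Real.log (D.absK v y (D.emb v y x)) = (D.α v y)⁻¹ * Real.log (D.absLv v x) := by
  rw [← alpha_mul_log_absK_emb D v y x, ← mul_assoc, inv_mul_cancel₀ (D.α_pos v y).ne', one_mul]

/-! ## [J-IV] (4.5.1)–(4.5.2): Tate parameters over a deformation datum and the Tate idele of `C/arith(L)_z` -/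

/-- **Input of [J-IV] (4.5.1)–(4.5.2) over a [J-2½] deformation datum** (p.42 l.75–88): the semistable support `V ⊂ V^non_L`
(finite; the primes of the reduced Tate divisor, §4.4) and «`q_v` a choice of the Tate parameter at `v` if `v ∈ V`»,
`q_v ∈ L_v^*` (only the values on `V` are used; off `V` the idele has coordinate `1`). SIGNATURE (data only, nothing asserted).
[claim: Joshi2024ATS4, status: disputed] -/
structure TateParams (D : ATS2h.DeformationDatum L V Lv Y K G A) where
  /-- the semistable support `V` of (4.5.2), a finite set of places -/
  bad : Finset V
  /-- the chosen Tate parameters `q_v ∈ L_v^*` ((4.5.2); used on `V` only) -/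
  q : ∀ v, (Lv v)ˣ

namespace TateParams

variable {D : ATS2h.DeformationDatum L V Lv Y K G A} (T : TateParams D)

/-- **The Tate idele of the holomorphoid `C/arith(L)_z`** ([J-IV] (4.5.1) p.42 l.77–88, «`TI_{C/arith(L)}` is an idele of `L`
(for `arith(L)`)» p.43 l.2) as an element of `∏_v K_{z_v}^*`, the unit group of the arithmetic ring of `arith(L)_z` ([J-2½]
Def. 5.1.1): coordinate `ι_{z_v}(q_v)` at `v ∈ V`, `1` elsewhere. [claim: Joshi2024ATS4, status: disputed] -/
def ideleK [DecidableEq V] (z : D.Arith) : ∀ v, (K v (z v))ˣ :=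
  fun v => if v ∈ T.bad then Units.map (D.emb v (z v)).toMonoidHom (T.q v) else 1

/-- Coordinates of the Tate idele on `V`. [claim: Joshi2024ATS4, status: disputed] -/
theorem ideleK_apply_of_mem [DecidableEq V] (z : D.Arith) {v : V} (hv : v ∈ T.bad) :
    (T.ideleK z v : K v (z v)) = D.emb v (z v) (T.q v) := by
  simp [ideleK, hv]

/-- Coordinates of the Tate idele off `V` ((4.5.2): `q_v = 1 if v ∈ V_L − V`). [claim: Joshi2024ATS4, status: disputed] -/
theorem ideleK_apply_of_not_mem [DecidableEq V] (z : D.Arith) {v : V} (hv : v ∉ T.bad) : T.ideleK z v = 1 := by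
  simp [ideleK, hv]

/-- The Tate idele lies in the ideloid of `arith(L)_z` ([J-2½] Def. 5.4.1: unit coordinates off a finite set) — so its
[J-2½] degree (Def. 5.4.3) is a genuine finite sum. [claim: Joshi2023ATS2half, status: disputed] -/
theorem ideleK_mem_ideloid [DecidableEq V] (z : D.Arith) : T.ideleK z ∈ D.ideloid z := by
  rw [DeformationDatum.mem_ideloid_iff, Filter.eventually_cofinite]
  refine T.bad.finite_toSet.subset fun v hv => ?_
  rw [Finset.mem_coe]
  by_contra hvb
  exact hv (by rw [T.ideleK_apply_of_not_mem z hvb, Units.val_one, (D.absK_isValuedField v (z v)).map_one])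

/-! ## (N) The [J-2½]-normalised degree of the Tate idele does not depend on the arithmeticoid -/

/-- The normalised local degree of the Tate idele at `v`: `log|q_v|_v` on `V`, `0` off `V` — for every `z`.
[claim: Joshi2024ATS4, status: disputed] -/
theorem alpha_mul_log_absK_ideleK [DecidableEq V] (z : D.Arith) (v : V) :
    D.α v (z v) * Real.log (D.absK v (z v) (T.ideleK z v : K v (z v))) =
      if v ∈ T.bad then Real.log (D.absLv v (T.q v)) else 0 := by
  by_cases hv : v ∈ T.bad
  · rw [if_pos hv, T.ideleK_apply_of_mem z hv, alpha_mul_log_absK_emb]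
  · rw [if_neg hv, T.ideleK_apply_of_not_mem z hv, Units.val_one, (D.absK_isValuedField v (z v)).map_one,
      Real.log_one, mul_zero]

/-- **[J-IV] §4.5 × [J-2½] Def. 5.4.3, PROVED:** the normalised arithmetic degree of the Tate idele of `C/arith(L)_z`,
`deg_z(TI_z) = Σ_v α_v(z_v)·log|ι_{z_v}(q_v)|_{K_{z_v}} = Σ_{v ∈ V} log|q_v|_v` — the right-hand side does not mention `z`.
[claim: Joshi2024ATS4, status: disputed] -/
theorem deg_ideleK [DecidableEq V] (z : D.Arith) :
    D.deg z (T.ideleK z) = ∑ v ∈ T.bad, Real.log (D.absLv v (T.q v)) := by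
  simp only [DeformationDatum.deg, T.alpha_mul_log_absK_ideleK z]
  rw [finsum_eq_sum_of_support_subset _ (s := T.bad) ?_]
  · exact Finset.sum_congr rfl fun v hv => if_pos hv
  · intro v hv
    rw [Function.mem_support] at hv
    rw [Finset.mem_coe]
    by_contra h
    exact hv (if_neg h)

/-- **Prop. 4.5.12 read over Joshi's own carriers, normalised side:** the [J-2½]-normalised degree of the Tate idele is the
SAME real number in every arithmeticoid `z ∈ 𝒴_L` (for Tate parameters `q_v ∈ L_v^*` transported by the untilt maps).
Located, not adjudicated. [claim: Joshi2024ATS4, status: disputed] -/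
theorem deg_ideleK_eq [DecidableEq V] (z z' : D.Arith) : D.deg z (T.ideleK z) = D.deg z' (T.ideleK z') := by
  rw [T.deg_ideleK, T.deg_ideleK]

/-! ## (R) The raw degree moves exactly with the normalisation coordinate `α` -/

/-- The RAW (un-normalised) degree of the Tate idele in `arith(L)_z`: `Σ_{v ∈ V} log|ι_{z_v}(q_v)|_{K_{z_v}}` — the degree one
obtains by measuring the Tate parameters with the arithmeticoid's own valuations `|−|_{K_{z_v}}` WITHOUT the coordinate
`α_v(z_v)` of (5.3.3) (cf. [J-IV] Thm. 3.3.1 and its proof, p.36 l.46 – p.37 l.3). [claim: Joshi2024ATS4, status: disputed] -/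
def rawDeg (z : D.Arith) : ℝ := ∑ v ∈ T.bad, Real.log (D.absK v (z v) (D.emb v (z v) (T.q v)))

/-- The raw degree in closed form: `Σ_{v ∈ V} α_v(z_v)⁻¹·log|q_v|_v`. [claim: Joshi2024ATS4, status: disputed] -/
theorem rawDeg_eq (z : D.Arith) : T.rawDeg z = ∑ v ∈ T.bad, (D.α v (z v))⁻¹ * Real.log (D.absLv v (T.q v)) :=
  Finset.sum_congr rfl fun v _ => log_absK_emb_eq D v (z v) (T.q v)

/-- Two arithmeticoids with the same normalisation coordinates on `V` have the same raw Tate degree.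
[claim: Joshi2024ATS4, status: disputed] -/
theorem rawDeg_eq_of_alpha_eq {z z' : D.Arith} (h : ∀ v ∈ T.bad, D.α v (z v) = D.α v (z' v)) :
    T.rawDeg z = T.rawDeg z' := by
  rw [T.rawDeg_eq, T.rawDeg_eq]
  exact Finset.sum_congr rfl fun v hv => by rw [h v hv]

/-- LOCATION: if the raw Tate degree differs between two arithmeticoids, then `α_v` differs between them at some `v ∈ V` —
all `z`-dependence is carried by (5.3.3)'s coordinate. [claim: Joshi2024ATS4, status: disputed] -/
theorem exists_alpha_ne_of_rawDeg_ne {z z' : D.Arith} (h : T.rawDeg z ≠ T.rawDeg z') :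
    ∃ v ∈ T.bad, D.α v (z v) ≠ D.α v (z' v) := by
  by_contra hc
  exact h (T.rawDeg_eq_of_alpha_eq fun v hv => not_ne_iff.1 fun hne => hc ⟨v, hv, hne⟩)

/-- One bad place `V = {v}` with `|q_v|_v ≠ 1`: the raw Tate degree differs between `z` and `z'` IFF `α_v(z_v) ≠ α_v(z'_v)`.
[claim: Joshi2024ATS4, status: disputed] -/
theorem rawDeg_ne_iff_of_bad_eq_singleton {v : V} (hbad : T.bad = {v}) (hq : Real.log (D.absLv v (T.q v)) ≠ 0)
    (z z' : D.Arith) : T.rawDeg z ≠ T.rawDeg z' ↔ D.α v (z v) ≠ D.α v (z' v) := by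
  rw [T.rawDeg_eq, T.rawDeg_eq, hbad, Finset.sum_singleton, Finset.sum_singleton, Ne, Ne, mul_left_inj' hq, inv_inj]

end TateParams

/-! ## Bridge to the typed [J-IV] carrier `TateIdeleDatum` and Prop. 4.5.12 (`TateDegreeNonConstant`) by name -/

/-- `TateParams` together with the INTEGER data of [J-IV] §4.2/§4.4 that E-t27's carrier `TateIdeleDatum` consumes: `[L:ℚ]`
((4.2.2) p.39 l.36–38), the normalised valuations `ord_v : L_v^* → ℤ` ((4.5.5) p.43 l.3–7), uniformisers `π_v`
(`ord_v(π_v) = 1`), «`log v` = the logarithm of the cardinality of the residue field» (§4.2 p.39 l.6–10), and the normalisation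
of the Artin–Whaples absolute value at the places of `V`: `log|x|_v = −ord_v(x)·log v` (standard at a non-archimedean place; a
HYPOTHESIS field on the input, discharged at any concrete number-field datum). SIGNATURE. [claim: Joshi2024ATS4, status: disputed] -/
structure TateParamsZ (D : ATS2h.DeformationDatum L V Lv Y K G A) extends TateParams D where
  /-- `[L : ℚ]` -/
  degQ : ℕ
  /-- `[L : ℚ] ≥ 1` -/
  degQ_pos : 0 < degQ
  /-- `ord_v : L_v^* → ℤ`, the normalised discrete valuation -/
  ordv : ∀ v, (Lv v)ˣ →* Multiplicative ℤ
  /-- a uniformiser `π_v ∈ L_v^*` at each place -/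
  unif : ∀ v, (Lv v)ˣ
  /-- «log v», the logarithm of the residue cardinality at `v` (§4.2) -/
  logNv : V → ℝ
  /-- `ord_v(π_v) = 1` on `V` -/
  ordv_unif : ∀ v ∈ bad, ordv v (unif v) = Multiplicative.ofAdd 1
  /-- normalisation of `|−|_v` on `V`: `log|x|_v = −ord_v(x)·log v` -/
  log_absLv_eq : ∀ v ∈ bad, ∀ x : (Lv v)ˣ,
    Real.log (D.absLv v x) = -((Multiplicative.toAdd (ordv v x) : ℤ) : ℝ) * logNv v

namespace TateParamsZ

variable {D : ATS2h.DeformationDatum L V Lv Y K G A} [DecidableEq V] (T : TateParamsZ D)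
  (H : V → Type) [∀ v, AddCommGroup (H v)] [∀ v, TopologicalSpace (H v)] (kum : ∀ v, (Lv v)ˣ →* Multiplicative (H v))

/-- **E-t27's [J-IV] §4.5 carrier instantiated over `𝒴_L`, «log v» read in the NORMALISED arithmeticoid `arith(L)^nor_z`**
(Prop. 4.5.12 p.44 l.24–26): `Y := 𝒴_L` (`D.Arith`), standard point `y⁰ := D.pt0`, `K z v := L_v^*` («`TI ∈ ∏_v L_v^*`», (4.5.1)),
`ord`, `q`, `[L:ℚ]` from `T`, the Kummer maps `L_v^* → L̃*_v` ((4.5.7), intrinsic to `L_v`) supplied as the parameter `kum`, and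
`logN z v := −α_v(z_v)·log|ι_{z_v}(π_v)|_{K_{z_v}}` — the normalised `K_{z_v}`-size of a uniformiser. A reading (def), no claim.
[claim: Joshi2024ATS4, status: disputed] -/
def datumNor : TateIdeleDatum D.Arith V (fun _ v => (Lv v)ˣ) (fun _ v => H v) where
  std := fun v => D.pt0 v
  bad := T.bad
  degQ := T.degQ
  degQ_pos := T.degQ_pos
  ord := fun _ v => T.ordv v
  q := fun _ v => T.q v
  kum := fun _ v => kum v
  logN := fun z v => -(D.α v (z v) * Real.log (D.absK v (z v) (D.emb v (z v) (T.unif v))))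

/-- The same carrier with «log v» read RAW in `arith(L)_z`: `logN z v := −log|ι_{z_v}(π_v)|_{K_{z_v}}` (no `α`). A reading
(def), no claim. [claim: Joshi2024ATS4, status: disputed] -/
def datumRaw : TateIdeleDatum D.Arith V (fun _ v => (Lv v)ˣ) (fun _ v => H v) where
  std := fun v => D.pt0 v
  bad := T.bad
  degQ := T.degQ
  degQ_pos := T.degQ_pos
  ord := fun _ v => T.ordv v
  q := fun _ v => T.q v
  kum := fun _ v => kum v
  logN := fun z v => -Real.log (D.absK v (z v) (D.emb v (z v) (T.unif v)))

/-- Projection: the support of `datumNor` is `V`. [claim: Joshi2024ATS4, status: disputed] -/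
@[simp] theorem datumNor_bad : (T.datumNor H kum).bad = T.bad := rfl
/-- Projection: the valuations of `datumNor` are `ord_v`, in every arithmeticoid. [claim: Joshi2024ATS4, status: disputed] -/
@[simp] theorem datumNor_ord (z : D.Arith) (v : V) : (T.datumNor H kum).ord z v = T.ordv v := rfl
/-- Projection: the Tate parameters of `datumNor` are `q_v`, in every arithmeticoid. [claim: Joshi2024ATS4, status: disputed] -/
@[simp] theorem datumNor_q (z : D.Arith) (v : V) : (T.datumNor H kum).q z v = T.q v := rfl
/-- Projection: the support of `datumRaw` is `V`. [claim: Joshi2024ATS4, status: disputed] -/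
@[simp] theorem datumRaw_bad : (T.datumRaw H kum).bad = T.bad := rfl
/-- Projection: the valuations of `datumRaw` are `ord_v`. [claim: Joshi2024ATS4, status: disputed] -/
@[simp] theorem datumRaw_ord (z : D.Arith) (v : V) : (T.datumRaw H kum).ord z v = T.ordv v := rfl
/-- Projection: the Tate parameters of `datumRaw` are `q_v`. [claim: Joshi2024ATS4, status: disputed] -/
@[simp] theorem datumRaw_q (z : D.Arith) (v : V) : (T.datumRaw H kum).q z v = T.q v := rfl

/-- In `arith(L)^nor_z` the normalised size of a uniformiser IS «log v», for every `z` ((5.3.3) + `ord_v(π_v) = 1`).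
[claim: Joshi2024ATS4, status: disputed] -/
theorem datumNor_logN_eq (z : D.Arith) {v : V} (hv : v ∈ T.bad) : (T.datumNor H kum).logN z v = T.logNv v := by
  show -(D.α v (z v) * Real.log (D.absK v (z v) (D.emb v (z v) (T.unif v)))) = T.logNv v
  rw [alpha_mul_log_absK_emb, T.log_absLv_eq v hv, T.ordv_unif v hv]
  simp

/-- **[J-IV] Prop. 4.5.12's function, computed:** in the normalised reading `log(TI_{C/arith(L)_z}) = [L:ℚ]⁻¹·Σ_{v ∈ V}
ord_v(q_v)·log v` — the (4.2.2)-degree of the Tate divisor `q_{C/L}` of (4.5.5), with no `z` on the right. PROVED.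
[claim: Joshi2024ATS4, status: disputed] -/
theorem datumNor_tateDegree_eq (z : D.Arith) :
    (T.datumNor H kum).tateDegree z =
      (T.degQ : ℝ)⁻¹ * ∑ v ∈ T.bad, ((Multiplicative.toAdd (T.ordv v (T.q v)) : ℤ) : ℝ) * T.logNv v := by
  unfold TateIdeleDatum.tateDegree
  refine congrArg₂ (· * ·) rfl (Finset.sum_congr rfl fun v hv => ?_)
  have hbad : v ∈ T.bad := by simpa using hv
  simp only [TateIdeleDatum.tateDivisor, datumNor_bad, datumNor_ord, datumNor_q, if_pos hbad,
    T.datumNor_logN_eq H kum z hbad]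

/-- The [J-IV] normalised Tate degree IS minus the [J-2½] normalised degree of the Tate idele, divided by `[L:ℚ]`
(`log|q_v|_v = −ord_v(q_v)·log v`). PROVED. [claim: Joshi2024ATS4, status: disputed] -/
theorem datumNor_tateDegree_eq_neg_deg (z : D.Arith) :
    (T.datumNor H kum).tateDegree z = -(T.degQ : ℝ)⁻¹ * D.deg z (T.ideleK z) := by
  rw [T.datumNor_tateDegree_eq H kum z, T.toTateParams.deg_ideleK z, neg_mul, ← mul_neg, ← Finset.sum_neg_distrib]
  refine congrArg₂ (· * ·) rfl (Finset.sum_congr rfl fun v hv => ?_)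
  rw [T.log_absLv_eq v hv (T.q v)]
  ring

/-- **TEST OF [J-IV] Prop. 4.5.12, normalised side (as printed, «`arith(L)^nor_z`»):** over Joshi's own [J-2½] carriers with
`L_v`-rational Tate parameters, the typed claim `TateDegreeNonConstant` FAILS — `z ↦ log(TI_{C/arith(L)_z})` is constant — by
E-t27's location lemma `not_tateDegreeNonConstant_of_indep` (neither `ord_v(q_v)` nor «log v» sees `z`). A located kernel fact
about the typed carriers; no side taken on what Joshi intends. [claim: Joshi2024ATS4, status: disputed] -/
theorem not_tateDegreeNonConstant_datumNor : ¬ (T.datumNor H kum).TateDegreeNonConstant :=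
  (T.datumNor H kum).not_tateDegreeNonConstant_of_indep (fun _ _ _ _ => rfl)
    (fun z z' v hv => by rw [T.datumNor_logN_eq H kum z hv, T.datumNor_logN_eq H kum z' hv])

/-- Raw reading: the un-normalised size of a uniformiser in `arith(L)_z` is `α_v(z_v)⁻¹·log v`.
[claim: Joshi2024ATS4, status: disputed] -/
theorem datumRaw_logN_eq (z : D.Arith) {v : V} (hv : v ∈ T.bad) :
    (T.datumRaw H kum).logN z v = (D.α v (z v))⁻¹ * T.logNv v := by
  show -Real.log (D.absK v (z v) (D.emb v (z v) (T.unif v))) = (D.α v (z v))⁻¹ * T.logNv v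
  rw [log_absK_emb_eq, T.log_absLv_eq v hv, T.ordv_unif v hv]
  simp

/-- Raw reading of Prop. 4.5.12's function: `[L:ℚ]⁻¹·Σ_{v ∈ V} α_v(z_v)⁻¹·(ord_v(q_v)·log v)`. PROVED.
[claim: Joshi2024ATS4, status: disputed] -/
theorem datumRaw_tateDegree_eq (z : D.Arith) :
    (T.datumRaw H kum).tateDegree z =
      (T.degQ : ℝ)⁻¹ * ∑ v ∈ T.bad,
        (D.α v (z v))⁻¹ * (((Multiplicative.toAdd (T.ordv v (T.q v)) : ℤ) : ℝ) * T.logNv v) := by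
  unfold TateIdeleDatum.tateDegree
  refine congrArg₂ (· * ·) rfl (Finset.sum_congr rfl fun v hv => ?_)
  have hbad : v ∈ T.bad := by simpa using hv
  simp only [TateIdeleDatum.tateDivisor, datumRaw_bad, datumRaw_ord, datumRaw_q, if_pos hbad,
    T.datumRaw_logN_eq H kum z hbad]
  ring

/-- Raw side: equal `α` on `V` ⇒ equal raw Tate degree. [claim: Joshi2024ATS4, status: disputed] -/
theorem datumRaw_tateDegree_eq_of_alpha_eq {z z' : D.Arith} (h : ∀ v ∈ T.bad, D.α v (z v) = D.α v (z' v)) :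
    (T.datumRaw H kum).tateDegree z = (T.datumRaw H kum).tateDegree z' := by
  rw [T.datumRaw_tateDegree_eq H kum z, T.datumRaw_tateDegree_eq H kum z']
  exact congrArg₂ (· * ·) rfl (Finset.sum_congr rfl fun v hv => by rw [h v hv])

/-- LOCATION, raw side: if the raw reading satisfies `TateDegreeNonConstant`, then the normalisation coordinate `α_v(z_v)`
takes two different values at some place of `V` — the non-constancy is (5.3.3)'s, cf. [J-IV] p.37 l.1–3.
[claim: Joshi2024ATS4, status: disputed] -/
theorem exists_alpha_ne_of_tateDegreeNonConstant_datumRaw (h : (T.datumRaw H kum).TateDegreeNonConstant) :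
    ∃ z z' : D.Arith, ∃ v ∈ T.bad, D.α v (z v) ≠ D.α v (z' v) := by
  obtain ⟨z, z', hne⟩ := h
  by_contra hc
  exact hne (T.datumRaw_tateDegree_eq_of_alpha_eq H kum fun v hv => not_ne_iff.1 fun hα => hc ⟨z, z', v, hv, hα⟩)

/-- Raw side, sufficiency: one bad place `V = {v}` with `ord_v(q_v) ≠ 0` and `log v ≠ 0`, and two arithmeticoids with
`α_v(z_v) ≠ α_v(z'_v)` ⇒ the RAW reading satisfies `TateDegreeNonConstant`. [claim: Joshi2024ATS4, status: disputed] -/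
theorem tateDegreeNonConstant_datumRaw_of {v : V} (hbad : T.bad = {v}) (hord : T.ordv v (T.q v) ≠ 1)
    (hN : T.logNv v ≠ 0) {z z' : D.Arith} (hα : D.α v (z v) ≠ D.α v (z' v)) :
    (T.datumRaw H kum).TateDegreeNonConstant := by
  refine ⟨z, z', fun heq => hα ?_⟩
  rw [T.datumRaw_tateDegree_eq H kum z, T.datumRaw_tateDegree_eq H kum z', hbad, Finset.sum_singleton,
    Finset.sum_singleton] at heq
  have hd : (T.degQ : ℝ)⁻¹ ≠ 0 := inv_ne_zero (Nat.cast_ne_zero.2 T.degQ_pos.ne')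
  have hord' : (Multiplicative.toAdd (T.ordv v (T.q v)) : ℤ) ≠ 0 := fun h0 =>
    hord (by simpa using congrArg Multiplicative.ofAdd h0)
  have hc : (((Multiplicative.toAdd (T.ordv v (T.q v)) : ℤ) : ℝ) * T.logNv v) ≠ 0 :=
    mul_ne_zero (Int.cast_ne_zero.2 hord') hN
  exact inv_inj.1 (mul_right_cancel₀ hc (mul_left_cancel₀ hd heq))

end TateParamsZ

/-! ## Non-vacuity of the dichotomy at the arithmetic model of the signature (any number field) -/

section Model

variable (F : Type) [Field F] [NumberField F]

/-- At seat E-t48's number-field model the normalisation coordinate along the Frobenius orbit is `α_v(y_n) = p_v^{−n}`.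
[folklore] -/
theorem model_alpha (v : NumberFieldModel.Place F) (n : ℤ) :
    (NumberFieldModel.model F).α v n = ((NumberFieldModel.resChar F v : ℝ) ^ n)⁻¹ := rfl

/-- **Raw side inhabited:** at the arithmetic model of ANY number field and any finite place `w`, there are Tate parameters
(one bad place `w`, `|q_w|_w ≠ 1`) and two arithmeticoids (`y_0` and its Frobenius translate `y_1`, where `α_w` is `1` resp.
`p_w⁻¹`) with DIFFERENT raw Tate degrees. [folklore] -/
theorem model_rawDeg_nonconstant (w : NumberField.FinitePlace F) :
    ∃ (T : TateParams (NumberFieldModel.model F)) (z z' : (NumberFieldModel.model F).Arith),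
      T.rawDeg z ≠ T.rawDeg z' := by
  obtain ⟨x, hx, h1⟩ := NumberFieldModel.exists_norm_toLoc_ne_one F (Sum.inr w)
  have hx' : ∀ v, NumberFieldModel.toLoc F v x ≠ 0 := fun v => by
    simpa [NumberFieldModel.toLoc] using hx
  refine ⟨⟨{Sum.inr w}, fun v => Units.mk0 _ (hx' v)⟩, fun _ => (0 : ℤ), fun _ => (1 : ℤ), ?_⟩
  have hq : Real.log ((NumberFieldModel.model F).absLv (Sum.inr w)
      ((Units.mk0 _ (hx' (Sum.inr w)) : (NumberFieldModel.Loc F (Sum.inr w))ˣ) : NumberFieldModel.Loc F (Sum.inr w))) ≠ 0 := by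
    show Real.log (NumberFieldModel.absLoc F (Sum.inr w) (NumberFieldModel.toLoc F (Sum.inr w) x)) ≠ 0
    rw [NumberFieldModel.absLoc_toLoc_inr]
    refine Real.log_ne_zero_of_pos_of_ne_one (NumberField.FinitePlace.pos_iff.2 hx) ?_
    rw [NumberFieldModel.norm_toLoc] at h1
    exact h1
  rw [TateParams.rawDeg_ne_iff_of_bad_eq_singleton _ rfl hq, model_alpha, model_alpha]
  show ((NumberFieldModel.resChar F (Sum.inr w) : ℝ) ^ (0 : ℤ))⁻¹ ≠
    ((NumberFieldModel.resChar F (Sum.inr w) : ℝ) ^ (1 : ℤ))⁻¹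
  rw [zpow_zero, inv_one, zpow_one, ne_eq, eq_comm, inv_eq_one]
  exact_mod_cast (NumberFieldModel.resChar_prime F w).one_lt.ne'

/-- **Normalised side at the same model:** the [J-2½]-normalised degree of the Tate idele is constant in the arithmeticoid
(instance of `TateParams.deg_ideleK_eq`) — both horns of the located dichotomy live on one datum of record. [folklore] -/
theorem model_deg_ideleK_eq [DecidableEq (NumberFieldModel.Place F)] (T : TateParams (NumberFieldModel.model F))
    (z z' : (NumberFieldModel.model F).Arith) :
    (NumberFieldModel.model F).deg z (T.ideleK z) = (NumberFieldModel.model F).deg z' (T.ideleK z') :=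
  T.deg_ideleK_eq z z'

end Model

end Summit.ABC.IUTFork.Joshi.ATS4
end
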